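import Summits.AtomisticToContinuum.Crystallization.Theorems.ChargedEnergyGapSquareSumA
import HarnessLib

/-!
# NODE 75 «SquareSum / Roof» (lens-3 g75), PART B (§5) — the RELABELLING SYMMETRY of square-sum certificates and the ROOF of a certified table

§5: square-sum certificates (`SqCert`, part A) are additive and positively homogeneous in `(W, ν)` (`SqCert.add/smul/sum`) and EQUIVARIANT under the
48 relabellings `relabel i j` of the octahedron's vertices (`sqCert_relabel` ★ PROVED, via the symmetric restatement `SqCertS`), so for any finite table
`T` of pointwise-certified patterns (`RoofTableQ C T`: `|T|` explicit 3×3 PSD conditions) the ROOF `roofVal T W = inf{Σ λₖ sₖ : W = Σ λₖ·(relabelled Wₖ),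
λ ≥ 0}` majorises `sqVal C W` (`sqVal_le_roofVal` ★ PROVED).  Part C fixes the table and proves the cone.  0 sorry.
-/

noncomputable section
open scoped Classical
open Literature.MathematicalPhysics.StatisticalMechanics Literature.Geometry.DiscreteGeometry
open Summit.AtomisticToContinuum.Crystallization.Theses.PricedLinkCensus
open Summit.AtomisticToContinuum.Crystallization.Theorems.ChargedEnergyGapNegative

namespace Summit.AtomisticToContinuum.Crystallization.Theorems.ChargedEnergyGapChartDial

/-! ## §5 The ROOF of a certificate table (PROVED): convexity + relabelling turn finitely many pointwise certificates into a majorant -/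

section Roof

/-- Symmetric form of one Cauchy–Schwarz clause of `SqCert` (the square with corners on the axes `a`, `b`). -/
def csClause (Wv : Fin 3 × Bool → ℝ) (a b : Fin 3) (l : ℝ) : Prop :=
  ∀ e : Bool → Bool → ℝ, l * (∑ s, ∑ t, e s t) ^ 2 ≤ ∑ s, ∑ t, (Wv (a, s) + Wv (b, t)) * e s t ^ 2

/-- Symmetric form of the 3×3 clause of `SqCert`. -/
def qClause (C : ℝ) (Wv : Fin 3 × Bool → ℝ) (ν : Fin 3 → ℝ) (L : Fin 3 → ℝ) : Prop :=
  ∀ x : Fin 3 → ℝ, 0 ≤ ∑ c, 2 * L c * ((∑ a, x a) - x c) ^ 2 - ∑ a, (C * (Wv (a, true) + Wv (a, false)) - 4 * ν a) * x a ^ 2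

/-- `va` (docstring added by the landing lane; see the module docstring). [formal bookkeeping] -/
def va : Fin 3 → Fin 3 := ![1, 0, 0]
/-- `vb` (docstring added by the landing lane; see the module docstring). [formal bookkeeping] -/
def vb : Fin 3 → Fin 3 := ![2, 2, 1]

/-- Symmetric restatement of `SqCert` (used only to prove the relabelling symmetry). -/
def SqCertS (C : ℝ) (Wv : Fin 3 × Bool → ℝ) (ν : Fin 3 → ℝ) : Prop :=
  (∀ a, 0 ≤ ν a) ∧ ∃ L : Fin 3 → ℝ, (∀ c, csClause Wv (va c) (vb c) (L c)) ∧ qClause C Wv ν L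

/-- `csClause_iff` (docstring added by the landing lane; see the module docstring). [formal bookkeeping] -/
theorem csClause_iff (Wv : Fin 3 × Bool → ℝ) (a b : Fin 3) (l : ℝ) :
    csClause Wv a b l ↔ ∀ e₁ e₂ e₃ e₄ : ℝ, l * (e₁ + e₂ + e₃ + e₄) ^ 2 ≤ (Wv (a, true) + Wv (b, true)) * e₁ ^ 2 +
      (Wv (a, true) + Wv (b, false)) * e₂ ^ 2 + (Wv (a, false) + Wv (b, true)) * e₃ ^ 2 + (Wv (a, false) + Wv (b, false)) * e₄ ^ 2 := by
  constructor
  · intro h e₁ e₂ e₃ e₄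
    have := h (fun s t => if s then (if t then e₁ else e₂) else (if t then e₃ else e₄))
    simpa [Fintype.sum_bool, add_assoc] using this
  · intro h e
    have := h (e true true) (e true false) (e false true) (e false false)
    simpa [Fintype.sum_bool, add_assoc] using this

/-- `sqCertS_iff` (docstring added by the landing lane; see the module docstring). [formal bookkeeping] -/
theorem sqCertS_iff (C : ℝ) (Wv : Fin 3 × Bool → ℝ) (ν : Fin 3 → ℝ) : SqCertS C Wv ν ↔ SqCert C Wv ν := by
  constructor
  · rintro ⟨hν, L, hc, hq⟩
    refine ⟨hν, L 0, L 1, L 2, ?_, ?_, ?_, fun x₀ x₁ x₂ => ?_⟩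
    · simpa [va, vb] using (csClause_iff _ _ _ _).1 (hc 0)
    · simpa [va, vb] using (csClause_iff _ _ _ _).1 (hc 1)
    · simpa [va, vb] using (csClause_iff _ _ _ _).1 (hc 2)
    · have := hq ![x₀, x₁, x₂]
      simp [Fin.sum_univ_three] at this
      nlinarith [this]
  · rintro ⟨hν, l₀, l₁, l₂, h₀, h₁, h₂, hQ⟩
    refine ⟨hν, ![l₀, l₁, l₂], fun c => ?_, fun x => ?_⟩
    · fin_cases c
      · simpa [va, vb] using (csClause_iff _ _ _ _).2 h₀
      · simpa [va, vb] using (csClause_iff _ _ _ _).2 h₁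
      · simpa [va, vb] using (csClause_iff _ _ _ _).2 h₂
    · have := hQ (x 0) (x 1) (x 2)
      simp [Fin.sum_univ_three]
      nlinarith [this]

/-- Re-indexing a square clause under pole flips of its two axes. -/
theorem csClause_reindex {Wv W' : Fin 3 × Bool → ℝ} {a b a' b' : Fin 3} {l : ℝ} (σ τ : Bool)
    (ha : ∀ s, W' (a, s) = Wv (a', xor σ s)) (hb : ∀ t, W' (b, t) = Wv (b', xor τ t)) (h : csClause Wv a' b' l) :
    csClause W' a b l := by
  intro e
  have := h (fun s t => e (xor σ s) (xor τ t))
  cases σ <;> cases τ <;> simp [ha, hb] at this ⊢ <;> linarith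

/-- `csClause_swap` (docstring added by the landing lane; see the module docstring). [formal bookkeeping] -/
theorem csClause_swap {Wv : Fin 3 × Bool → ℝ} {a b : Fin 3} {l : ℝ} (h : csClause Wv a b l) : csClause Wv b a l := by
  intro e
  have := h (fun s t => e t s)
  simp at this ⊢
  linarith

/-- The six axis permutations (with their inverses) and the eight pole-flip patterns: the 48 relabellings of the octahedron's vertices. -/
def axp : Fin 6 → Fin 3 → Fin 3 := ![![0, 1, 2], ![0, 2, 1], ![1, 0, 2], ![1, 2, 0], ![2, 0, 1], ![2, 1, 0]]
/-- `axpInv` (docstring added by the landing lane; see the module docstring). [formal bookkeeping] -/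
def axpInv : Fin 6 → Fin 3 → Fin 3 := ![![0, 1, 2], ![0, 2, 1], ![1, 0, 2], ![2, 0, 1], ![1, 2, 0], ![2, 1, 0]]
/-- `sgn` (docstring added by the landing lane; see the module docstring). [formal bookkeeping] -/
def sgn : Fin 8 → Fin 3 → Bool :=
  ![![false, false, false], ![true, false, false], ![false, true, false], ![true, true, false],
    ![false, false, true], ![true, false, true], ![false, true, true], ![true, true, true]]

/-- A RELABELLING of the six vertices `Fin 3 × Bool`: axis permutation `axp i` and pole-flip pattern `sgn j`. -/
def relabel (i : Fin 6) (j : Fin 8) (p : Fin 3 × Bool) : Fin 3 × Bool := (axp i p.1, xor (sgn j p.1) p.2)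

/-- `sum_axpInv` (docstring added by the landing lane; see the module docstring). [formal bookkeeping] -/
theorem sum_axpInv (i : Fin 6) (x : Fin 3 → ℝ) : ∑ a, x (axpInv i a) = ∑ a, x a := by
  fin_cases i <;> simp [axpInv, Fin.sum_univ_three] <;> ring

/-- `qClause_relabel` (docstring added by the landing lane; see the module docstring). [formal bookkeeping] -/
theorem qClause_relabel {C : ℝ} {Wv : Fin 3 × Bool → ℝ} {ν : Fin 3 → ℝ} {L : Fin 3 → ℝ} (i : Fin 6) (j : Fin 8)
    (h : qClause C Wv ν L) : qClause C (fun p => Wv (relabel i j p)) (fun a => ν (axp i a)) (fun c => L (axp i c)) := by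
  intro x
  have hS : ∀ a, Wv (relabel i j (a, true)) + Wv (relabel i j (a, false)) = Wv (axp i a, true) + Wv (axp i a, false) := by
    intro a; simp only [relabel]; cases sgn j a <;> simp [add_comm]
  simp only [hS]
  have := h (fun a => x (axpInv i a))
  rw [sum_axpInv] at this
  fin_cases i <;> simp [axp, axpInv, Fin.sum_univ_three] at this ⊢ <;> linarith

/-- `sqCertS_relabel` (docstring added by the landing lane; see the module docstring). [formal bookkeeping] -/
theorem sqCertS_relabel {C : ℝ} {Wv : Fin 3 × Bool → ℝ} {ν : Fin 3 → ℝ} (i : Fin 6) (j : Fin 8) (h : SqCertS C Wv ν) :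
    SqCertS C (fun p => Wv (relabel i j p)) (fun a => ν (axp i a)) := by
  obtain ⟨hν, L, hc, hq⟩ := h
  refine ⟨fun a => hν _, fun c => L (axp i c), fun c => ?_, qClause_relabel i j hq⟩
  have key : ∀ a, ∀ s, (fun p => Wv (relabel i j p)) (a, s) = Wv (axp i a, xor (sgn j a) s) := fun a s => rfl
  fin_cases i <;> fin_cases c <;>
    first
      | exact csClause_reindex _ _ (key _) (key _) (by simpa [va, vb, axp] using hc 0)
      | exact csClause_reindex _ _ (key _) (key _) (by simpa [va, vb, axp] using hc 1)
      | exact csClause_reindex _ _ (key _) (key _) (by simpa [va, vb, axp] using hc 2)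
      | exact csClause_reindex _ _ (key _) (key _) (csClause_swap (by simpa [va, vb, axp] using hc 0))
      | exact csClause_reindex _ _ (key _) (key _) (csClause_swap (by simpa [va, vb, axp] using hc 1))
      | exact csClause_reindex _ _ (key _) (key _) (csClause_swap (by simpa [va, vb, axp] using hc 2))

/-- ★ **RELABELLING SYMMETRY (PROVED)**: a square-sum certificate for `W` is one for every relabelled `W ∘ relabel i j` (multipliers permuted). -/
theorem sqCert_relabel {C : ℝ} {Wv : Fin 3 × Bool → ℝ} {ν : Fin 3 → ℝ} (i : Fin 6) (j : Fin 8) (h : SqCert C Wv ν) :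
    SqCert C (fun p => Wv (relabel i j p)) (fun a => ν (axp i a)) :=
  (sqCertS_iff _ _ _).1 (sqCertS_relabel i j ((sqCertS_iff _ _ _).2 h))

/-- `nuSum_axp` (docstring added by the landing lane; see the module docstring). [formal bookkeeping] -/
theorem nuSum_axp (i : Fin 6) (ν : Fin 3 → ℝ) : ν (axp i 0) + ν (axp i 1) + ν (axp i 2) = ν 0 + ν 1 + ν 2 := by
  fin_cases i <;> simp [axp] <;> ring


/-- A weight sextuple from six numbers, in the order `(0,+) (0,−) (1,+) (1,−) (2,+) (2,−)`. -/
def sext (a b c d e g : ℝ) (p : Fin 3 × Bool) : ℝ := if p.2 then ![a, c, e] p.1 else ![b, d, g] p.1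

/-- The ROOF SET of a table `T` of (pattern, value) pairs at `Wv`: the values `Σ λᵢ sᵢ` of all representations `Wv = Σ λᵢ · (relabelled Wᵢ)`,
`λ ≥ 0`, by relabelled table patterns. -/
def roofSet (T : List ((Fin 3 × Bool → ℝ) × ℝ)) (Wv : Fin 3 × Bool → ℝ) : Set ℝ :=
  {t | ∃ (n : ℕ) (w : Fin n → (Fin 3 × Bool → ℝ) × ℝ) (g : Fin n → Fin 6) (σ : Fin n → Fin 8) (lam : Fin n → ℝ),
    (∀ i, w i ∈ T) ∧ (∀ i, 0 ≤ lam i) ∧ (∀ p, Wv p = ∑ i, lam i * (w i).1 (relabel (g i) (σ i) p)) ∧ t = ∑ i, lam i * (w i).2}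

/-- ★ The **ROOF** of the table: the least value of a representation (`0` if there is none) — the LP value `min{Σλᵢsᵢ : Σλᵢ·gᵢWᵢ = W, λ ≥ 0}`. -/
def roofVal (T : List ((Fin 3 × Bool → ℝ) × ℝ)) (Wv : Fin 3 × Bool → ℝ) : ℝ := sInf (roofSet T Wv)

/-- ★★ **(M_T) THE TABLE CERTIFICATES** (finite, residual): every table pattern `Wₖ` has a square-sum certificate at `C` of total multiplier `≤ sₖ` —
`|T|` explicit conditions «a rational 3×3 matrix is positive semidefinite» (the relabellings are free by `sqCert_relabel`).  Certified in exact rational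
arithmetic by `num75/tableS.py`; the certificates `(lₖ, νₖ)` are shipped in `num75/tableS.json`.  [residual · TRUE (certified) · FINITE · support;
door [TABLE-CERT]] -/
def RoofTableQ (C : ℝ) (T : List ((Fin 3 × Bool → ℝ) × ℝ)) : Prop :=
  ∀ e ∈ T, ∃ ν, SqCert C e.1 ν ∧ ν 0 + ν 1 + ν 2 ≤ e.2

/-- `sqCert_zero` (docstring added by the landing lane; see the module docstring). [formal bookkeeping] -/
theorem sqCert_zero (C : ℝ) : SqCert C (fun _ => 0) (fun _ => 0) := by
  refine ⟨fun _ => le_rfl, 0, 0, 0, ?_, ?_, ?_, ?_⟩ <;> intros <;> simp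

/-- `SqCert.add` (docstring added by the landing lane; see the module docstring). [formal bookkeeping] -/
theorem SqCert.add {C : ℝ} {W W' : Fin 3 × Bool → ℝ} {ν ν' : Fin 3 → ℝ} (h : SqCert C W ν) (h' : SqCert C W' ν') :
    SqCert C (fun p => W p + W' p) (fun a => ν a + ν' a) := by
  obtain ⟨hν, l₀, l₁, l₂, h₀, h₁, h₂, hQ⟩ := h
  obtain ⟨hν', l₀', l₁', l₂', h₀', h₁', h₂', hQ'⟩ := h'
  refine ⟨fun a => add_nonneg (hν a) (hν' a), l₀ + l₀', l₁ + l₁', l₂ + l₂', ?_, ?_, ?_, ?_⟩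
  · intro e₁ e₂ e₃ e₄; have := h₀ e₁ e₂ e₃ e₄; have := h₀' e₁ e₂ e₃ e₄; linarith
  · intro e₁ e₂ e₃ e₄; have := h₁ e₁ e₂ e₃ e₄; have := h₁' e₁ e₂ e₃ e₄; linarith
  · intro e₁ e₂ e₃ e₄; have := h₂ e₁ e₂ e₃ e₄; have := h₂' e₁ e₂ e₃ e₄; linarith
  · intro x₀ x₁ x₂; have := hQ x₀ x₁ x₂; have := hQ' x₀ x₁ x₂; linarith

/-- `SqCert.smul` (docstring added by the landing lane; see the module docstring). [formal bookkeeping] -/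
theorem SqCert.smul {C : ℝ} {W : Fin 3 × Bool → ℝ} {ν : Fin 3 → ℝ} {c : ℝ} (hc : 0 ≤ c) (h : SqCert C W ν) :
    SqCert C (fun p => c * W p) (fun a => c * ν a) := by
  obtain ⟨hν, l₀, l₁, l₂, h₀, h₁, h₂, hQ⟩ := h
  refine ⟨fun a => mul_nonneg hc (hν a), c * l₀, c * l₁, c * l₂, ?_, ?_, ?_, ?_⟩
  · intro e₁ e₂ e₃ e₄; have := mul_le_mul_of_nonneg_left (h₀ e₁ e₂ e₃ e₄) hc; linarith
  · intro e₁ e₂ e₃ e₄; have := mul_le_mul_of_nonneg_left (h₁ e₁ e₂ e₃ e₄) hc; linarith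
  · intro e₁ e₂ e₃ e₄; have := mul_le_mul_of_nonneg_left (h₂ e₁ e₂ e₃ e₄) hc; linarith
  · intro x₀ x₁ x₂; have := mul_le_mul_of_nonneg_left (hQ x₀ x₁ x₂) hc; linarith

/-- Non-negative combinations of certified patterns are certified (the CONVEXITY of the certificate cone). -/
theorem SqCert.sum {C : ℝ} {n : ℕ} {W : Fin n → Fin 3 × Bool → ℝ} {ν : Fin n → Fin 3 → ℝ} {lam : Fin n → ℝ}
    (hl : ∀ i, 0 ≤ lam i) (h : ∀ i, SqCert C (W i) (ν i)) :
    SqCert C (fun p => ∑ i, lam i * W i p) (fun a => ∑ i, lam i * ν i a) := by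
  induction n with
  | zero => simpa using sqCert_zero C
  | succ n ih =>
    have key := (ih (W := fun i => W i.castSucc) (ν := fun i => ν i.castSucc) (lam := fun i => lam i.castSucc) (fun i => hl _)
      (fun i => h _)).add (SqCert.smul (hl (Fin.last n)) (h (Fin.last n)))
    convert key using 2 <;> simp [Fin.sum_univ_castSucc]

/-- ★★ **THE ROOF LEMMA (PROVED)**: certified table ⟹ `sqVal ≤ roof` wherever a representation exists. -/
theorem sqVal_le_roofVal {C : ℝ} {T : List ((Fin 3 × Bool → ℝ) × ℝ)} (hT : RoofTableQ C T) {Wv : Fin 3 × Bool → ℝ}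
    (hne : (roofSet T Wv).Nonempty) : sqVal C Wv ≤ roofVal T Wv := by
  classical
  refine le_csInf hne ?_
  rintro t ⟨n, w, g, σ, lam, hw, hl, hW, rfl⟩
  choose ν hν hle using fun i => hT _ (hw i)
  have hc := SqCert.sum (lam := lam) hl fun i => sqCert_relabel (g i) (σ i) (hν i)
  have hWf : Wv = fun p => ∑ i, lam i * (w i).1 (relabel (g i) (σ i) p) := funext hW
  rw [hWf]
  refine (sqVal_le hc).trans ?_
  rw [← Finset.sum_add_distrib, ← Finset.sum_add_distrib]
  refine Finset.sum_le_sum fun i _ => ?_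
  have := hle i; have := hl i; have := nuSum_axp (g i) (ν i)
  nlinarith

end Roof

end Summit.AtomisticToContinuum.Crystallization.Theorems.ChargedEnergyGapChartDial
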